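import Literature.Barriers.NavierStokesRegularity.NavierStokesInequalityStructureRecipeProofs
import Literature.Barriers.NavierStokesRegularity.NavierStokesInequalityProfileMargin
import Literature.Analysis.Calculus.SmoothTransitionDerivatives
import HarnessLib

/-!
# Scheffer's block, decomposed (2″): the ring cut-off proved (Ożański 2017, Thm. 3.4, Lemma 22)

Barrier catalogue support file for `NavierStokesRegularity` (D-0021). It DISCHARGES the named
fact `Ozanski2017_cutoff_ring` of `NavierStokesInequalityStructureRecipe` — Ożański's
Theorem 3.4 in the case of a rectangular ring `U = V ∖ W̄` (arXiv:1709.00602v4, App. A, "the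
cut-off function on a rectangular ring", Lemma 22 of the held text; V. Scheffer, Comm. Math.
Phys. 101 (1985), Lemma 5.5): given `η > 0` there are `δ ∈ (0, η)` and `f ∈ C^∞(ℝ²; [0,1])`
with `supp f = Ū`, `f > 0` in `U`, `f = 1` on `U_η` and `Lf > 0` on `U ∖ U_δ`. The rectangle
case `Ozanski2017_cutoff_rect_holds` (`NavierStokesInequalityStructureRecipeProofs`) is used as
printed ("`g := f̃` on `P ∖ W^η`, `f` on `W^η`, where `f̃` is from the previous lemma applied to
`V`").

## The printed proof and this rendering

Both sources reduce the ring to an INNER cut-off around `W̄ = [a₁,b₁] × [a₂,b₂]`: a function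
vanishing exactly on `W̄`, equal to `1` outside the `η`-neighbourhood `W^η`, with `L > 0` on
`W^δ ∖ W̄`, built from one-dimensional profiles `fᵢ` with `fᵢ = 0` on `[aᵢ,bᵢ]`, `fᵢ = 1` off
`(aᵢ-η, bᵢ+η)`, exponential next to `aᵢ`, `bᵢ` (Ożański: "constructed by a use of the
exponential function, as in the previous lemma"; Scheffer: `exp(-(aᵢ-x)⁻²)`, `exp(-(x-bᵢ)⁻²)`).
Near `W̄` the printed function is the SUM `h = f₁(x₁) + f₂(x₂)` — Scheffer (5.8):
`L(h) = (f₁'' - f₁/x₂²) + (f₂'' + f₂'/x₂ - f₂/x₂²)`, and Ożański's displayed `Lf` is this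
formula although his text writes a product — followed by "we can construct a `C^∞` function
`g : ℝ² → [0,1]` such that `g = 1` off `(a₁-d,b₁+d) × (a₂-d,b₂+d)`, `0 < g ≤ 1` off `W̄`,
`g = h` on the `δ`-neighbourhood" (Scheffer), a modification neither source spells out. Here:

* the profiles are explicit: `D(x) = h_η(x - b) + h_η(a - x)` with the step `h_η = cutoffStep η`
  of the rectangle case (`= expNegInvGlue` on `(-∞, η/2]`, `= 1` on `[η, ∞)`), so that
  `D = E(x - b)` on `(a, b + ε)` and `D = E(a - x)` on `(a - ε, b)`, `E(t) = e^{-1/t}`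
  (`exists_dipProfile`); the conclusions of Ożański's Corollary 20 (Scheffer's Lemmas 5.1–5.2:
  `f'' > 0`, `0 ≤ ±f' ≤ (dist) f''`, `f ≤ (dist)² f''`) are verified directly for `E` on
  `(0, 1/4]` from the closed forms `E' = t⁻²E`, `E'' = (t⁻⁴ - 2t⁻³)E`
  (`Literature.Analysis.Calculus.deriv_expNegInvGlue`, `deriv2_expNegInvGlue`), together with
  `E ≤ 1/2` there (`expNegInvGlue_edge`);
* the smooth `[0,1]`-valued modification is explicit: `g = 1 - (1 - D_R(r))(1 - D_Z(z))`
  (`= D_R + D_Z - D_R D_Z`; `{g = 0} = W̄`; `g = 1` off the `η`-enlargement), and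
  `Lg = (1 - D_Z)(D_R'' + D_R'/r - D_R/r²) + (1 - D_R) D_Z'' - D_Z/r²` exactly (`opL_one_sub`,
  `opL_mul_sep`), which is positive on the `δ`-collar of `W̄` by the three cases of the printed
  proof — axially above/below `W̄` (`D_R ≡ 0` there: `Lg = D_Z'' - D_Z/r²`), radially beside
  it (`D_Z ≡ 0`: `Lg` is the radial part, `≥ D_R''/4` — the "Claim" `g₂ > f₂''/4`), and at the
  corners (`cutoff_collar_core`);
* the ring cut-off is the product `f̃ · g` of the rectangle cut-off of `V` and `g`, both taken
  with margin `η'' = min(η, gap/4)`, `gap = dist(W̄, ∂V)` (sup metric), so that `g ≡ 1` near the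
  outer `δ`-frame and `f̃ ≡ 1` near the inner `δ`-collar; `L` being local
  (`opL_congr_of_eventuallyEq`), `L(f̃g)` is `Lf̃ > 0`, resp. `Lg > 0`, there.

`U_η` is rendered with the sup metric as in the statement (see its docstring). No new
definitions and no new facts are introduced.

## References

* W. S. Ożański, arXiv:1709.00602v4, Thm. 3.4, App. A (Cor. 20, Lemmas 21–22 of the held
  text, with proofs). [`Ozanski2017NSISingular`]
* V. Scheffer, Comm. Math. Phys. 101 (1985), 47–85, §5 "Edge effects", Lemmas 5.1–5.2, 5.5
  (pp. 74–77). [`Scheffer1985`]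
-/

noncomputable section

open Set Function Filter Topology Metric Real
open scoped ContDiff

namespace Literature.Barriers.NavierStokesRegularity

/-! ### The glue function `E(t) = e^{-1/t}` (`expNegInvGlue`) next to `0⁺` -/

/-- **The edge inequalities for the explicit profile** (the rôle of Ożański's Corollary 20 /
Scheffer's Lemmas 5.1–5.2, here by direct computation for `E(t) = e^{-1/t}`): for
`0 < t ≤ 1/4`, `E'' (t) > 0`, `0 ≤ E'(t) ≤ t E''(t)`, `E(t) ≤ t² E''(t)` and `E(t) ≤ 1/2`.
[cite: Ozanski2017NSISingular, App. A, Corollary 20] [cite: Scheffer1985, Lemmas 5.1–5.2] -/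
theorem expNegInvGlue_edge {t : ℝ} (ht : 0 < t) (ht4 : t ≤ 1 / 4) :
    0 < (t⁻¹ ^ 4 - 2 * t⁻¹ ^ 3) * expNegInvGlue t ∧
    0 ≤ t⁻¹ ^ 2 * expNegInvGlue t ∧
    t⁻¹ ^ 2 * expNegInvGlue t ≤ t * ((t⁻¹ ^ 4 - 2 * t⁻¹ ^ 3) * expNegInvGlue t) ∧
    expNegInvGlue t ≤ t ^ 2 * ((t⁻¹ ^ 4 - 2 * t⁻¹ ^ 3) * expNegInvGlue t) ∧
    expNegInvGlue t ≤ 1 / 2 := by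
  have hE : 0 < expNegInvGlue t := expNegInvGlue.pos_of_pos ht
  have hu : 4 ≤ t⁻¹ := by
    rw [le_inv_comm₀ (by norm_num) ht]; simpa [one_div] using ht4
  have hu0 : 0 < t⁻¹ := by positivity
  have htu : t * t⁻¹ = 1 := mul_inv_cancel₀ ht.ne'
  have h1 : 0 < t⁻¹ ^ 4 - 2 * t⁻¹ ^ 3 := by
    have : t⁻¹ ^ 4 - 2 * t⁻¹ ^ 3 = t⁻¹ ^ 3 * (t⁻¹ - 2) := by ring
    rw [this]; exact mul_pos (pow_pos hu0 3) (by linarith)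
  refine ⟨mul_pos h1 hE, by positivity, ?_, ?_, ?_⟩
  · have : t * ((t⁻¹ ^ 4 - 2 * t⁻¹ ^ 3) * expNegInvGlue t) - t⁻¹ ^ 2 * expNegInvGlue t =
        t⁻¹ ^ 2 * (t⁻¹ - 3) * expNegInvGlue t := by
      have e1 : t * t⁻¹ ^ 4 = t⁻¹ ^ 3 := by
        rw [show t⁻¹ ^ 4 = t⁻¹ * t⁻¹ ^ 3 by ring, ← mul_assoc, htu, one_mul]
      have e2 : t * t⁻¹ ^ 3 = t⁻¹ ^ 2 := by
        rw [show t⁻¹ ^ 3 = t⁻¹ * t⁻¹ ^ 2 by ring, ← mul_assoc, htu, one_mul]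
      have : t * (t⁻¹ ^ 4 - 2 * t⁻¹ ^ 3) = t⁻¹ ^ 3 - 2 * t⁻¹ ^ 2 := by
        rw [mul_sub, e1, ← mul_assoc, mul_comm t 2, mul_assoc, e2]
      calc t * ((t⁻¹ ^ 4 - 2 * t⁻¹ ^ 3) * expNegInvGlue t) - t⁻¹ ^ 2 * expNegInvGlue t
          = (t * (t⁻¹ ^ 4 - 2 * t⁻¹ ^ 3) - t⁻¹ ^ 2) * expNegInvGlue t := by ring
        _ = _ := by rw [this]; ring
    have h2 : 0 ≤ t⁻¹ ^ 2 * (t⁻¹ - 3) * expNegInvGlue t :=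
      mul_nonneg (mul_nonneg (by positivity) (by linarith)) hE.le
    linarith
  · have e1 : t ^ 2 * t⁻¹ ^ 4 = t⁻¹ ^ 2 := by
      rw [show t⁻¹ ^ 4 = t⁻¹ ^ 2 * t⁻¹ ^ 2 by ring, ← mul_assoc, ← mul_pow, htu, one_pow, one_mul]
    have e2 : t ^ 2 * t⁻¹ ^ 3 = t⁻¹ := by
      rw [show t⁻¹ ^ 3 = t⁻¹ ^ 2 * t⁻¹ by ring, ← mul_assoc, ← mul_pow, htu, one_pow, one_mul]
    have : t ^ 2 * ((t⁻¹ ^ 4 - 2 * t⁻¹ ^ 3) * expNegInvGlue t) =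
        (t⁻¹ ^ 2 - 2 * t⁻¹) * expNegInvGlue t := by
      rw [← mul_assoc, mul_sub, e1, ← mul_assoc, mul_comm (t ^ 2) 2, mul_assoc, e2]
    rw [this]
    have h3 : 1 ≤ t⁻¹ ^ 2 - 2 * t⁻¹ := by nlinarith
    nlinarith
  · have hEt : expNegInvGlue t = Real.exp (-t⁻¹) := by simp [expNegInvGlue, not_le.2 ht]
    rw [hEt]
    have h4 : Real.exp (-t⁻¹) ≤ Real.exp (-4) := Real.exp_le_exp.2 (by linarith)
    have h5 : Real.exp (-4) ≤ 1 / 2 := by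
      rw [Real.exp_neg]
      have h6 : (4 : ℝ) + 1 ≤ Real.exp 4 := Real.add_one_le_exp 4
      rw [inv_le_comm₀ (Real.exp_pos 4) (by norm_num)]
      linarith
    exact h4.trans h5

/-! ### Transfer of derivatives along local equalities -/

/-- Functions that agree on an open set have the same derivative there. [folklore] -/
theorem eqOn_deriv_of_isOpen {f g : ℝ → ℝ} {s : Set ℝ} (hs : IsOpen s) (h : EqOn f g s) :
    EqOn (deriv f) (deriv g) s := fun _ hx =>
  (Filter.eventuallyEq_of_mem (hs.mem_nhds hx) h).deriv_eq

/-- Functions that agree on an open set have the same second derivative there. [folklore] -/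
theorem eqOn_deriv2_of_isOpen {f g : ℝ → ℝ} {s : Set ℝ} (hs : IsOpen s) (h : EqOn f g s) :
    EqOn (deriv (deriv f)) (deriv (deriv g)) s :=
  eqOn_deriv_of_isOpen hs (eqOn_deriv_of_isOpen hs h)

/-- Derivatives of the translated glue function `x ↦ E(x - c)`. [folklore] -/
theorem deriv_expNegInvGlue_comp_sub (c x : ℝ) :
    deriv (fun y => expNegInvGlue (y - c)) x = (x - c)⁻¹ ^ 2 * expNegInvGlue (x - c) ∧
    deriv (deriv fun y => expNegInvGlue (y - c)) x =
      ((x - c)⁻¹ ^ 4 - 2 * (x - c)⁻¹ ^ 3) * expNegInvGlue (x - c) := by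
  have h1 : deriv (fun y => expNegInvGlue (y - c)) = fun y => deriv expNegInvGlue (y - c) :=
    funext fun y => deriv_comp_sub_const _ _ _
  refine ⟨?_, ?_⟩
  · rw [h1, Literature.Analysis.Calculus.deriv_expNegInvGlue]
  · rw [h1]
    rw [show deriv (fun y => deriv expNegInvGlue (y - c)) x = deriv (deriv expNegInvGlue) (x - c)
      from deriv_comp_sub_const _ _ _, Literature.Analysis.Calculus.deriv2_expNegInvGlue]

/-- Derivatives of the reflected glue function `x ↦ E(c - x)`. [folklore] -/
theorem deriv_expNegInvGlue_comp_const_sub (c x : ℝ) :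
    deriv (fun y => expNegInvGlue (c - y)) x = -((c - x)⁻¹ ^ 2 * expNegInvGlue (c - x)) ∧
    deriv (deriv fun y => expNegInvGlue (c - y)) x =
      ((c - x)⁻¹ ^ 4 - 2 * (c - x)⁻¹ ^ 3) * expNegInvGlue (c - x) := by
  have h1 : deriv (fun y => expNegInvGlue (c - y)) = fun y => -deriv expNegInvGlue (c - y) :=
    funext fun y => deriv_comp_const_sub _ _ _
  refine ⟨?_, ?_⟩
  · rw [h1, Literature.Analysis.Calculus.deriv_expNegInvGlue]
  · rw [h1, deriv.fun_neg,
      show deriv (fun y => deriv expNegInvGlue (c - y)) x = -deriv (deriv expNegInvGlue) (c - x)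
      from deriv_comp_const_sub _ _ _, Literature.Analysis.Calculus.deriv2_expNegInvGlue,
      neg_neg]

/-! ### The dip profile vanishing exactly on `[a, b]` -/

/-- **The dip profile vanishing exactly on `[a, b]`** (the `fᵢ` of the proof of Lemma 22:
"`fᵢ = 1` outside `(aᵢ - η, bᵢ + η)`, `fᵢ = 0` on `(aᵢ, bᵢ)`", "constructed by a use of the
exponential function, as in the previous lemma"; Scheffer, proof of Lemma 5.5): for
`0 < 2ε ≤ η` and `a < b` there is `D ∈ C^∞(ℝ; [0,1])` with `{D = 0} = [a, b]`, `D = 1` off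
`(a - η, b + η)`, `D(x) = E(x - b)` on `(a, b + ε)` and `D(x) = E(a - x)` on `(a - ε, b)`
(`E = expNegInvGlue`) together with the corresponding first and second derivatives, and
`D = D' = D'' = 0` on `[a, b]`; namely `D(x) = h_η(x - b) + h_η(a - x)` with the step `h_η` of
the rectangle case (`cutoffStep`). [cite: Ozanski2017NSISingular, App. A, proof of Lemma 22] -/
theorem exists_dipProfile {a b ε η : ℝ} (hε : 0 < ε) (hεη : 2 * ε ≤ η) (hab : a < b) :
    ∃ D : ℝ → ℝ, ContDiff ℝ ∞ D ∧ (∀ x, 0 ≤ D x) ∧ (∀ x, D x ≤ 1) ∧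
      (∀ x, D x = 0 ↔ x ∈ Icc a b) ∧
      (∀ x, b + η ≤ x → D x = 1) ∧ (∀ x, x ≤ a - η → D x = 1) ∧
      (∀ x ∈ Ioo a (b + ε), D x = expNegInvGlue (x - b) ∧
        deriv D x = (x - b)⁻¹ ^ 2 * expNegInvGlue (x - b) ∧
        deriv (deriv D) x = ((x - b)⁻¹ ^ 4 - 2 * (x - b)⁻¹ ^ 3) * expNegInvGlue (x - b)) ∧
      (∀ x ∈ Ioo (a - ε) b, D x = expNegInvGlue (a - x) ∧
        deriv D x = -((a - x)⁻¹ ^ 2 * expNegInvGlue (a - x)) ∧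
        deriv (deriv D) x = ((a - x)⁻¹ ^ 4 - 2 * (a - x)⁻¹ ^ 3) * expNegInvGlue (a - x)) ∧
      (∀ x ∈ Icc a b, D x = 0 ∧ deriv D x = 0 ∧ deriv (deriv D) x = 0) := by
  have hη : 0 < η := by linarith
  set ρ : ℝ → ℝ := cutoffStep η with hρ
  have hρs : ContDiff ℝ ∞ ρ := cutoffStep_contDiff η
  have hρE : ∀ s, s ≤ ε → ρ s = expNegInvGlue s := fun s hs =>
    cutoffStep_of_le_half hη (by linarith)
  have hρ1 : ∀ s, η ≤ s → ρ s = 1 := fun s hs => cutoffStep_of_le hη hs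
  have hρ0 : ∀ s, s ≤ 0 → ρ s = 0 := fun s hs => cutoffStep_of_nonpos hη hs
  have hρpos : ∀ s, 0 < s → 0 < ρ s := fun s hs => cutoffStep_pos hs
  have hρnn : ∀ s, 0 ≤ ρ s := fun s => cutoffStep_nonneg η s
  have hρle : ∀ s, ρ s ≤ 1 := fun s => cutoffStep_le_one η s
  set D : ℝ → ℝ := fun x => ρ (x - b) + ρ (a - x) with hD
  have hgt : ∀ x, a < x → D x = ρ (x - b) := fun x hx => by
    show ρ (x - b) + ρ (a - x) = _
    rw [hρ0 (a - x) (by linarith), add_zero]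
  have hlt : ∀ x, x < b → D x = ρ (a - x) := fun x hx => by
    show ρ (x - b) + ρ (a - x) = _
    rw [hρ0 (x - b) (by linarith), zero_add]
  have hzero : ∀ x ∈ Icc a b, D x = 0 := fun x hx => by
    rcases eq_or_lt_of_le hx.1 with h | h
    · rw [hlt x (h ▸ hab), hρ0 _ (by linarith)]
    · rw [hgt x h, hρ0 _ (by linarith [hx.2])]
  have hposD : ∀ x, x ∉ Icc a b → 0 < D x := fun x hx => by
    rcases lt_or_ge x a with h | h
    · rw [hlt x (h.trans hab)]; exact hρpos _ (by linarith)
    · have hb : b < x := by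
        by_contra h'
        exact hx ⟨h, not_lt.1 h'⟩
      rw [hgt x (hab.trans hb)]; exact hρpos _ (by linarith)
  have hR : EqOn D (fun x => expNegInvGlue (x - b)) (Ioo a (b + ε)) := fun x hx => by
    show D x = _
    rw [hgt x hx.1, hρE _ (by linarith [hx.2])]
  have hL : EqOn D (fun x => expNegInvGlue (a - x)) (Ioo (a - ε) b) := fun x hx => by
    show D x = _
    rw [hlt x hx.2, hρE _ (by linarith [hx.1])]
  have hright : ∀ x ∈ Ioo a (b + ε), D x = expNegInvGlue (x - b) ∧
      deriv D x = (x - b)⁻¹ ^ 2 * expNegInvGlue (x - b) ∧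
      deriv (deriv D) x = ((x - b)⁻¹ ^ 4 - 2 * (x - b)⁻¹ ^ 3) * expNegInvGlue (x - b) :=
    fun x hx => ⟨hR hx,
      by rw [eqOn_deriv_of_isOpen isOpen_Ioo hR hx, (deriv_expNegInvGlue_comp_sub b x).1],
      by rw [eqOn_deriv2_of_isOpen isOpen_Ioo hR hx, (deriv_expNegInvGlue_comp_sub b x).2]⟩
  have hleft : ∀ x ∈ Ioo (a - ε) b, D x = expNegInvGlue (a - x) ∧
      deriv D x = -((a - x)⁻¹ ^ 2 * expNegInvGlue (a - x)) ∧
      deriv (deriv D) x = ((a - x)⁻¹ ^ 4 - 2 * (a - x)⁻¹ ^ 3) * expNegInvGlue (a - x) :=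
    fun x hx => ⟨hL hx,
      by rw [eqOn_deriv_of_isOpen isOpen_Ioo hL hx, (deriv_expNegInvGlue_comp_const_sub a x).1],
      by rw [eqOn_deriv2_of_isOpen isOpen_Ioo hL hx, (deriv_expNegInvGlue_comp_const_sub a x).2]⟩
  refine ⟨D, ?_, fun x => add_nonneg (hρnn _) (hρnn _), ?_, ?_, ?_, ?_, hright, hleft, ?_⟩
  · exact (hρs.comp (contDiff_id.sub contDiff_const)).add
      (hρs.comp (contDiff_const.sub contDiff_id))
  · intro x
    rcases lt_or_ge a x with h | h
    · rw [hgt x h]; exact hρle _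
    · rw [hlt x (h.trans_lt hab)]; exact hρle _
  · exact fun x => ⟨fun h => by_contra fun hx => (hposD x hx).ne' h, hzero x⟩
  · intro x hx
    rw [hgt x (by linarith), hρ1 _ (by linarith)]
  · intro x hx
    rw [hlt x (by linarith), hρ1 _ (by linarith)]
  · intro x hx
    rcases eq_or_lt_of_le hx.1 with h | h
    · subst h
      have h3 := hleft a ⟨by linarith, hab⟩
      simp only [sub_self, expNegInvGlue.zero, mul_zero, neg_zero] at h3
      exact h3
    · have h3 := hright x ⟨h, by linarith [hx.2]⟩
      rw [expNegInvGlue.zero_of_nonpos (by linarith [hx.2] : x - b ≤ 0)] at h3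
      simp only [mul_zero] at h3
      exact h3

/-! ### Positivity of `L` on the inner collar: the core estimate -/

/-- The radial part `A = G'' + r⁻¹ G' - G/r²` of `L` is at least `G''/4` when
`|G'| ≤ δ G''`, `G ≤ δ² G''`, `G'' > 0` and `r ≥ 2δ > 0` (Ożański's "Claim": `g₂ > f₂''/4`).
[cite: Ozanski2017NSISingular, App. A, proof of Lemma 21 (Claim)] -/
theorem opL_radial_ge_quarter {r δ G0 G1 G2 : ℝ} (hr : 0 < r) (hδ : 0 ≤ δ) (hrδ : 2 * δ ≤ r)
    (h2 : 0 < G2) (h1 : |G1| ≤ δ * G2) (h0' : G0 ≤ δ ^ 2 * G2) :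
    G2 / 4 ≤ G2 + r⁻¹ * G1 - G0 / r ^ 2 := by
  have hab := abs_le.1 h1
  have e1 : -(r * (δ * G2)) ≤ r * G1 := by
    have := mul_le_mul_of_nonneg_left hab.1 hr.le
    linarith
  have e2 : r * δ * G2 ≤ r ^ 2 / 2 * G2 := mul_le_mul_of_nonneg_right (by nlinarith) h2.le
  have e3 : δ ^ 2 * G2 ≤ r ^ 2 / 4 * G2 := mul_le_mul_of_nonneg_right (by nlinarith) h2.le
  have key : 0 ≤ 3 * r ^ 2 * G2 / 4 + r * G1 - G0 := by nlinarith
  have : G2 + r⁻¹ * G1 - G0 / r ^ 2 - G2 / 4 = (3 * r ^ 2 * G2 / 4 + r * G1 - G0) / r ^ 2 := by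
    field_simp
    ring
  have h3 : 0 ≤ (3 * r ^ 2 * G2 / 4 + r * G1 - G0) / r ^ 2 := div_nonneg key (by positivity)
  linarith

/-- `h/r² ≤ h''/4` from `h ≤ δ² h''` and `r ≥ 2δ`. [folklore] -/
theorem div_sq_le_quarter {h0 h2 r δ : ℝ} (hr : 0 < r) (hδ0 : 0 ≤ δ) (hrδ : 2 * δ ≤ r)
    (hh2 : 0 ≤ h2) (hhδ : h0 ≤ δ ^ 2 * h2) : h0 / r ^ 2 ≤ h2 / 4 := by
  rw [div_le_iff₀ (by positivity)]
  have e1 : δ ^ 2 * h2 ≤ r ^ 2 / 4 * h2 := mul_le_mul_of_nonneg_right (by nlinarith) hh2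
  linarith

/-- Arithmetic of the inner collar at a corner: `(1 - h) A + (1 - g) h'' - h/r² > 0` from
`h ≤ 1`, `A ≥ 0`, `g ≤ 1/2`, `h'' > 0`, `h ≤ δ² h''`, `r ≥ 2δ`.
[cite: Ozanski2017NSISingular, App. A, proof of Lemma 22] -/
theorem collar_pos {h0 h2 A g0 r δ : ℝ} (hr : 0 < r) (hδ0 : 0 ≤ δ) (hrδ : 2 * δ ≤ r)
    (hh1 : h0 ≤ 1) (hA : 0 ≤ A) (hg : g0 ≤ 1 / 2) (hh2 : 0 < h2) (hhδ : h0 ≤ δ ^ 2 * h2) :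
    0 < (1 - h0) * A + (1 - g0) * h2 - h0 / r ^ 2 := by
  have h1 : 0 ≤ (1 - h0) * A := mul_nonneg (by linarith) hA
  have h2' : 1 / 2 * h2 ≤ (1 - g0) * h2 := mul_le_mul_of_nonneg_right (by linarith) hh2.le
  have h3 := div_sq_le_quarter hr hδ0 hrδ hh2.le hhδ
  linarith

/-- **Core of the ring lemma, inner collar** (Ożański, proof of Lemma 22; Scheffer, Lemma 5.5):
for dip profiles `g` (radial, vanishing exactly on `[a, b]`, `a > 0`) and `h` (axial, on `[c, d]`),
flat on their intervals and with the edge inequalities within `e` outside them, there is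
`δ ∈ (0, e)` such that `L(1 - (1 - g)(1 - h)) = (1 - h)(g'' + g'/r - g/r²) + (1 - g) h'' - h/r² > 0`
on the closed `δ`-collar of `[a, b] × [c, d]` minus the rectangle itself (three cases: beside,
above/below, and at the corners of `W̄`).
[cite: Ozanski2017NSISingular, App. A, proof of Lemma 22] [cite: Scheffer1985, Lemma 5.5] -/
theorem cutoff_collar_core {g h : ℝ → ℝ} {a b c d e : ℝ} (ha : 0 < a) (hab : a ≤ b)
    (he : 0 < e)
    (hh1 : ∀ z, h z ≤ 1)
    (hgz : ∀ x ∈ Icc a b, g x = 0 ∧ deriv g x = 0 ∧ deriv (deriv g) x = 0)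
    (hhz : ∀ z ∈ Icc c d, h z = 0 ∧ deriv h z = 0 ∧ deriv (deriv h) z = 0)
    (hgr : ∀ x ∈ Ioo b (b + e), 0 < deriv (deriv g) x ∧ 0 ≤ deriv g x ∧
      deriv g x ≤ (x - b) * deriv (deriv g) x ∧ g x ≤ (x - b) ^ 2 * deriv (deriv g) x ∧
      g x ≤ 1 / 2)
    (hgl : ∀ x ∈ Ioo (a - e) a, 0 < deriv (deriv g) x ∧ deriv g x ≤ 0 ∧
      -deriv g x ≤ (a - x) * deriv (deriv g) x ∧ g x ≤ (a - x) ^ 2 * deriv (deriv g) x ∧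
      g x ≤ 1 / 2)
    (hhr : ∀ z ∈ Ioo d (d + e), 0 < deriv (deriv h) z ∧ h z ≤ (z - d) ^ 2 * deriv (deriv h) z)
    (hhl : ∀ z ∈ Ioo (c - e) c, 0 < deriv (deriv h) z ∧ h z ≤ (c - z) ^ 2 * deriv (deriv h) z) :
    ∃ δ : ℝ, 0 < δ ∧ δ < e ∧ ∀ r z : ℝ, r ∈ Icc (a - δ) (b + δ) → z ∈ Icc (c - δ) (d + δ) →
      ¬(r ∈ Icc a b ∧ z ∈ Icc c d) →
      0 < (1 - h z) * (deriv (deriv g) r + r⁻¹ * deriv g r - g r / r ^ 2) +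
        (1 - g r) * deriv (deriv h) z - h z / r ^ 2 := by
  set δ : ℝ := min (e / 2) (a / 3) with hδ
  have hδpos : 0 < δ := lt_min (by linarith) (by linarith)
  have hδe : δ < e := (min_le_left _ _).trans_lt (by linarith)
  have hδa : δ ≤ a / 3 := min_le_right _ _
  refine ⟨δ, hδpos, hδe, fun r z hr hz hnot => ?_⟩
  have hr0 : 0 < r := by linarith [hr.1]
  have hrδ : 2 * δ ≤ r := by linarith [hr.1]
  -- `h'' > 0` and `h ≤ δ² h''` off `[c, d]`
  have hzout : z ∉ Icc c d → 0 < deriv (deriv h) z ∧ h z ≤ δ ^ 2 * deriv (deriv h) z := by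
    intro hzI
    rcases lt_or_ge z c with hzc | hzc
    · obtain ⟨h2, h0⟩ := hhl z ⟨by linarith [hz.1], hzc⟩
      refine ⟨h2, h0.trans (mul_le_mul_of_nonneg_right ?_ h2.le)⟩
      nlinarith [hz.1]
    · have hzd : d < z := by
        by_contra h'
        exact hzI ⟨hzc, not_lt.1 h'⟩
      obtain ⟨h2, h0⟩ := hhr z ⟨hzd, by linarith [hz.2]⟩
      refine ⟨h2, h0.trans (mul_le_mul_of_nonneg_right ?_ h2.le)⟩
      nlinarith [hz.2]
  by_cases hrI : r ∈ Icc a b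
  · -- beside `W̄` radially inside: `g = g' = g'' = 0`, `L = h'' - h/r²`
    obtain ⟨hg0, hg1, hg2⟩ := hgz r hrI
    obtain ⟨hh2, hhδ⟩ := hzout fun h => hnot ⟨hrI, h⟩
    rw [hg0, hg1, hg2]
    have h3 := div_sq_le_quarter hr0 hδpos.le hrδ hh2.le hhδ
    have : (1 - h z) * (0 + r⁻¹ * 0 - 0 / r ^ 2) + (1 - 0) * deriv (deriv h) z - h z / r ^ 2 =
        deriv (deriv h) z - h z / r ^ 2 := by ring
    rw [this]
    linarith
  · -- radially outside `[a, b]`: the radial part is at least `g''/4 > 0`, and `g ≤ 1/2`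
    obtain ⟨hg2, hA, hghalf⟩ : 0 < deriv (deriv g) r ∧
        deriv (deriv g) r / 4 ≤ deriv (deriv g) r + r⁻¹ * deriv g r - g r / r ^ 2 ∧
        g r ≤ 1 / 2 := by
      rcases lt_or_ge r a with hra | hra
      · obtain ⟨h2, h1, h1', h0', hg⟩ := hgl r ⟨by linarith [hr.1], hra⟩
        exact ⟨h2, opL_radial_ge_quarter hr0 (by linarith) (by linarith [hr.1]) h2
          (by rw [abs_of_nonpos h1]; exact h1') h0', hg⟩
      · have hrb : b < r := by
          by_contra h'
          exact hrI ⟨hra, not_lt.1 h'⟩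
        obtain ⟨h2, h1, h1', h0', hg⟩ := hgr r ⟨hrb, by linarith [hr.2]⟩
        exact ⟨h2, opL_radial_ge_quarter hr0 (by linarith) (by linarith [hr.2]) h2
          (by rw [abs_of_nonneg h1]; exact h1') h0', hg⟩
    by_cases hzI : z ∈ Icc c d
    · -- above/below: `h = h'' = 0`, `L = A`
      obtain ⟨hh0, -, hh2⟩ := hhz z hzI
      rw [hh0, hh2]
      have : (1 - 0) * (deriv (deriv g) r + r⁻¹ * deriv g r - g r / r ^ 2) + (1 - g r) * 0 -
          0 / r ^ 2 = deriv (deriv g) r + r⁻¹ * deriv g r - g r / r ^ 2 := by ring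
      rw [this]
      linarith
    · -- the corners of the collar
      obtain ⟨hh2, hhδ⟩ := hzout hzI
      exact collar_pos hr0 hδpos.le hrδ (hh1 z) (by linarith) hghalf hh2 hhδ

/-! ### The operator `L` on `1 - P` -/

/-- `L(1 - P) = -LP - 1/r²` (no differentiability needed with the junk-value conventions).
[folklore] -/
theorem opL_one_sub (P : ℝ × ℝ → ℝ) (q : ℝ × ℝ) :
    opL (fun p => 1 - P p) q = -opL P q - 1 / q.1 ^ 2 := by
  have hR : derivR (fun p => 1 - P p) = fun p => -derivR P p := by
    funext p; simp only [derivR, fderiv_const_sub, neg_apply]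
  have hZ : derivZ (fun p => 1 - P p) = fun p => -derivZ P p := by
    funext p; simp only [derivZ, fderiv_const_sub, neg_apply]
  have hRR : derivR (fun p => -derivR P p) q = -derivR (derivR P) q := by
    show fderiv ℝ (fun p => -derivR P p) q (1, 0) = -(fderiv ℝ (derivR P) q (1, 0))
    rw [fderiv_fun_neg, neg_apply]
  have hZZ : derivZ (fun p => -derivZ P p) q = -derivZ (derivZ P) q := by
    show fderiv ℝ (fun p => -derivZ P p) q (0, 1) = -(fderiv ℝ (derivZ P) q (0, 1))
    rw [fderiv_fun_neg, neg_apply]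
  rw [opL, opL, hR, hZ, hRR, hZZ]
  ring

/-- For `u, v ∈ [0, 1]`: `u v = 1 ↔ u = 1 ∧ v = 1`. [folklore] -/
theorem mul_eq_one_iff_of_mem_Icc {u v : ℝ} (hu : u ∈ Icc (0 : ℝ) 1) (hv : v ∈ Icc (0 : ℝ) 1) :
    u * v = 1 ↔ u = 1 ∧ v = 1 := by
  refine ⟨fun h => ?_, fun h => by rw [h.1, h.2, mul_one]⟩
  have h1 : u * v ≤ u := mul_le_of_le_one_right hu.1 hv.2
  have h2 : u * v ≤ v := mul_le_of_le_one_left hv.1 hu.2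
  exact ⟨le_antisymm hu.2 (h ▸ h1), le_antisymm hv.2 (h ▸ h2)⟩

/-! ### From the rectangle fact: the exact support -/

/-- For a continuous `f` with `tsupport f = Ū`, `U` an open rectangle, and `f > 0` on `U`:
`{f ≠ 0} = U` (the support is open, hence inside the interior `U` of the closed rectangle).
[folklore] -/
theorem support_eq_rect_of_tsupport {f : ℝ × ℝ → ℝ} (hf : Continuous f) {R₁ R₂ Z₁ Z₂ : ℝ}
    (hs : tsupport f = closure (rect R₁ R₂ Z₁ Z₂)) (hpos : ∀ q ∈ rect R₁ R₂ Z₁ Z₂, 0 < f q) :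
    support f = rect R₁ R₂ Z₁ Z₂ := by
  refine Subset.antisymm ?_ fun q hq => (hpos q hq).ne'
  have h1 : support f ⊆ interior (crect R₁ R₂ Z₁ Z₂) :=
    interior_maximal ((subset_tsupport f).trans (by rw [hs]; exact closure_rect_subset _ _ _ _))
      (hf.isOpen_support)
  have h2 : interior (crect R₁ R₂ Z₁ Z₂) = rect R₁ R₂ Z₁ Z₂ := by
    rw [crect, interior_prod_eq, interior_Icc, interior_Icc, rect]
  rw [← h2]
  exact h1

/-! ### The inner cut-off around `W̄` (Ożański Lemma 22; Scheffer Lemma 5.5) -/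

/-- **The inner cut-off of a rectangular ring, explicit form**: for `W̄ = [r₁,r₂] × [z₁,z₂]`,
`r₁ > 0`, and `η > 0` there are `δ ∈ (0, η)` and `g ∈ C^∞(ℝ²; [0,1])` with `{g = 0} = W̄`,
`g = 1` off the open `η`-enlargement of `W̄` (sup metric), and `Lg > 0` on the closed
`δ`-enlargement of `W̄` minus `W̄`; here `g = 1 - (1 - D_{[r₁,r₂]}(r))(1 - D_{[z₁,z₂]}(z))`
with the dip profiles (Ożański: "`f = 0` on `W̄`, `f > 0` outside `W̄` with `f = 1` outside
`W^η` and `Lf > 0` in `W^δ ∖ W̄`"; Scheffer: the function `g` of Lemma 5.5).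
[cite: Ozanski2017NSISingular, App. A, Lemma 22 (proof)] [cite: Scheffer1985, Lemma 5.5] -/
theorem exists_cutoff_collar {r₁ r₂ z₁ z₂ : ℝ} (hr₁ : 0 < r₁) (hr : r₁ < r₂) (hz : z₁ < z₂)
    {η : ℝ} (hη : 0 < η) :
    ∃ δ ∈ Ioo (0 : ℝ) η, ∃ g : ℝ × ℝ → ℝ, ContDiff ℝ ∞ g ∧ (∀ q, g q ∈ Icc (0 : ℝ) 1) ∧
      (∀ q, g q = 0 ↔ q ∈ crect r₁ r₂ z₁ z₂) ∧
      (∀ q : ℝ × ℝ, (q.1 ≤ r₁ - η ∨ r₂ + η ≤ q.1 ∨ q.2 ≤ z₁ - η ∨ z₂ + η ≤ q.2) → g q = 1) ∧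
      (∀ q ∈ crect (r₁ - δ) (r₂ + δ) (z₁ - δ) (z₂ + δ) \ crect r₁ r₂ z₁ z₂, 0 < opL g q) := by
  set ε : ℝ := min (η / 2) (1 / 4) with hε
  have hεpos : 0 < ε := lt_min (by linarith) (by norm_num)
  have hεη2 : 2 * ε ≤ η := by
    have := min_le_left (η / 2) (1 / 4)
    linarith
  have hεη : ε < η := by linarith
  have hε4 : ε ≤ 1 / 4 := min_le_right _ _
  obtain ⟨Dr, hDrs, hDr0, hDr1, hDrz, hDrge, hDrle, hDrR, hDrL, hDrflat⟩ :=
    exists_dipProfile hεpos hεη2 hr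
  obtain ⟨Dz, hDzs, hDz0, hDz1, hDzz, hDzge, hDzle, hDzR, hDzL, hDzflat⟩ :=
    exists_dipProfile hεpos hεη2 hz
  -- edge inequalities for the dips
  have hgr : ∀ x ∈ Ioo r₂ (r₂ + ε), 0 < deriv (deriv Dr) x ∧ 0 ≤ deriv Dr x ∧
      deriv Dr x ≤ (x - r₂) * deriv (deriv Dr) x ∧ Dr x ≤ (x - r₂) ^ 2 * deriv (deriv Dr) x ∧
      Dr x ≤ 1 / 2 := by
    intro x hx
    obtain ⟨h0, h1, h2⟩ := hDrR x ⟨hr.trans hx.1, hx.2⟩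
    obtain ⟨e2, e1, e3, e4, e5⟩ := expNegInvGlue_edge (t := x - r₂) (by linarith [hx.1])
      (by linarith [hx.2])
    rw [h0, h1, h2]
    exact ⟨e2, e1, e3, e4, e5⟩
  have hgl : ∀ x ∈ Ioo (r₁ - ε) r₁, 0 < deriv (deriv Dr) x ∧ deriv Dr x ≤ 0 ∧
      -deriv Dr x ≤ (r₁ - x) * deriv (deriv Dr) x ∧ Dr x ≤ (r₁ - x) ^ 2 * deriv (deriv Dr) x ∧
      Dr x ≤ 1 / 2 := by
    intro x hx
    obtain ⟨h0, h1, h2⟩ := hDrL x ⟨hx.1, hx.2.trans hr⟩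
    obtain ⟨e2, e1, e3, e4, e5⟩ := expNegInvGlue_edge (t := r₁ - x) (by linarith [hx.2])
      (by linarith [hx.1])
    rw [h0, h1, h2, neg_neg]
    exact ⟨e2, by linarith, e3, e4, e5⟩
  have hhr : ∀ x ∈ Ioo z₂ (z₂ + ε), 0 < deriv (deriv Dz) x ∧
      Dz x ≤ (x - z₂) ^ 2 * deriv (deriv Dz) x := by
    intro x hx
    obtain ⟨h0, -, h2⟩ := hDzR x ⟨hz.trans hx.1, hx.2⟩
    obtain ⟨e2, -, -, e4, -⟩ := expNegInvGlue_edge (t := x - z₂) (by linarith [hx.1])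
      (by linarith [hx.2])
    rw [h0, h2]
    exact ⟨e2, e4⟩
  have hhl : ∀ x ∈ Ioo (z₁ - ε) z₁, 0 < deriv (deriv Dz) x ∧
      Dz x ≤ (z₁ - x) ^ 2 * deriv (deriv Dz) x := by
    intro x hx
    obtain ⟨h0, -, h2⟩ := hDzL x ⟨hx.1, hx.2.trans hz⟩
    obtain ⟨e2, -, -, e4, -⟩ := expNegInvGlue_edge (t := z₁ - x) (by linarith [hx.2])
      (by linarith [hx.1])
    rw [h0, h2]
    exact ⟨e2, e4⟩
  obtain ⟨δ, hδpos, hδε, hcol⟩ := cutoff_collar_core (g := Dr) (h := Dz) hr₁ hr.le hεpos hDz1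
    hDrflat hDzflat hgr hgl hhr hhl
  have hu : ∀ x, 1 - Dr x ∈ Icc (0 : ℝ) 1 := fun x =>
    ⟨sub_nonneg.2 (hDr1 x), sub_le_self _ (hDr0 x)⟩
  have hv : ∀ x, 1 - Dz x ∈ Icc (0 : ℝ) 1 := fun x =>
    ⟨sub_nonneg.2 (hDz1 x), sub_le_self _ (hDz0 x)⟩
  refine ⟨δ, ⟨hδpos, hδε.trans hεη⟩, fun q => 1 - (1 - Dr q.1) * (1 - Dz q.2), ?_, ?_, ?_, ?_,
    ?_⟩
  · exact contDiff_const.sub ((contDiff_const.sub (hDrs.comp contDiff_fst)).mul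
      (contDiff_const.sub (hDzs.comp contDiff_snd)))
  · intro q
    have h1 := hu q.1
    have h2 := hv q.2
    exact ⟨sub_nonneg.2 (mul_le_one₀ h1.2 h2.1 h2.2), by nlinarith [mul_nonneg h1.1 h2.1]⟩
  · intro q
    rw [sub_eq_zero, eq_comm, mul_eq_one_iff_of_mem_Icc (hu q.1) (hv q.2), sub_eq_self,
      sub_eq_self, hDrz, hDzz, mem_crect, mem_Icc, mem_Icc]
  · intro q hq
    change 1 - (1 - Dr q.1) * (1 - Dz q.2) = 1
    rcases hq with h | h | h | h
    · rw [hDrle q.1 h]; ring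
    · rw [hDrge q.1 h]; ring
    · rw [hDzle q.2 h]; ring
    · rw [hDzge q.2 h]; ring
  · intro q hq
    have hq1 := mem_crect.1 hq.1
    have hq2 : ¬(q.1 ∈ Icc r₁ r₂ ∧ q.2 ∈ Icc z₁ z₂) := fun h =>
      hq.2 (mem_crect.2 ⟨⟨h.1.1, h.1.2⟩, h.2.1, h.2.2⟩)
    have key := hcol q.1 q.2 ⟨hq1.1.1, hq1.1.2⟩ ⟨hq1.2.1, hq1.2.2⟩ hq2
    have hG2 : ContDiff ℝ 2 (fun x => 1 - Dr x) := contDiff_const.sub (hDrs.of_le (by norm_cast))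
    have hF2 : ContDiff ℝ 2 (fun x => 1 - Dz x) := contDiff_const.sub (hDzs.of_le (by norm_cast))
    have hd1 : deriv (fun x => 1 - Dr x) = fun x => -deriv Dr x := deriv_const_sub' 1
    have hd2 : deriv (fun x => -deriv Dr x) = fun x => -deriv (deriv Dr) x :=
      funext fun x => deriv.fun_neg
    have hd3 : deriv (fun x => 1 - Dz x) = fun x => -deriv Dz x := deriv_const_sub' 1
    have hd4 : deriv (fun x => -deriv Dz x) = fun x => -deriv (deriv Dz) x :=
      funext fun x => deriv.fun_neg
    rw [opL_one_sub (fun p => (1 - Dr p.1) * (1 - Dz p.2)) q,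
      opL_mul_sep (G := fun x => 1 - Dr x) (F := fun x => 1 - Dz x) hG2 hF2]
    simp only [hd1, hd2, hd3, hd4]
    convert key using 1
    ring

/-! ### The discharge -/

/-- **Ożański 2017, Theorem 3.4, rectangular-ring case — proved** (`Ozanski2017_cutoff_ring`;
App. A, Lemma 22; Scheffer 1985, Lemma 5.5): `f = f̃ · g` with `f̃` the rectangle cut-off of
`V` (`Ozanski2017_cutoff_rect_holds`) and `g` the inner cut-off around `W̄`
(`exists_cutoff_collar`), both
with margin `η'' = min(η, gap/4)` so that the two transition zones are separated (`g ≡ 1`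
near `V ∖ V_δ`, `f̃ ≡ 1` near the `δ`-collar of `W̄`, whence `Lf = Lf̃`, resp. `Lf = Lg`, there).
[cite: Ozanski2017NSISingular, Theorem 3.4 and App. A, Lemma 22] [cite: Scheffer1985, Lemma 5.5] -/
theorem Ozanski2017_cutoff_ring_holds : Ozanski2017_cutoff_ring := by
  intro R₁ R₂ Z₁ Z₂ r₁ r₂ z₁ z₂ hR₁ h₁ h₂ h₃ h₄ h₅ h₆ η hη
  -- the gap between `W̄` and `∂V`, and the working margin `η''`
  set gap : ℝ := min (min (r₁ - R₁) (R₂ - r₂)) (min (z₁ - Z₁) (Z₂ - z₂)) with hgap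
  have hgap0 : 0 < gap :=
    lt_min (lt_min (by linarith) (by linarith)) (lt_min (by linarith) (by linarith))
  have hg1 : gap ≤ r₁ - R₁ := (min_le_left _ _).trans (min_le_left _ _)
  have hg2 : gap ≤ R₂ - r₂ := (min_le_left _ _).trans (min_le_right _ _)
  have hg3 : gap ≤ z₁ - Z₁ := (min_le_right _ _).trans (min_le_left _ _)
  have hg4 : gap ≤ Z₂ - z₂ := (min_le_right _ _).trans (min_le_right _ _)
  set η'' : ℝ := min η (gap / 4) with hη''
  have hη''0 : 0 < η'' := lt_min hη (by linarith)
  have hη''η : η'' ≤ η := min_le_left _ _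
  have hη''g : 4 * η'' ≤ gap := by
    have := min_le_right η (gap / 4)
    linarith
  -- outer (the rectangle case, `Ozanski2017_cutoff_rect_holds`) and inner cut-offs, margin `η''`
  obtain ⟨δ₁, ⟨hδ₁, hδ₁η⟩, F, hF, hF01, hFts, hFpos, hFone, hFL, -⟩ :=
    Ozanski2017_cutoff_rect_holds R₁ R₂ Z₁ Z₂ hR₁ (by linarith) (by linarith) η'' hη''0
  have hFsupp : support F = rect R₁ R₂ Z₁ Z₂ :=
    support_eq_rect_of_tsupport hF.continuous hFts hFpos
  obtain ⟨δ₂, ⟨hδ₂, hδ₂η⟩, Fi, hFi, hFi01, hFi0, hFi1, hFiL⟩ :=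
    exists_cutoff_collar (hR₁.trans h₁) h₂ h₅ hη''0
  set δ : ℝ := min δ₁ δ₂ with hδ
  have hδ0 : 0 < δ := lt_min hδ₁ hδ₂
  have hδδ₁ : δ ≤ δ₁ := min_le_left _ _
  have hδδ₂ : δ ≤ δ₂ := min_le_right _ _
  -- the product and its support
  have hsupp : support (fun q => F q * Fi q) = rect R₁ R₂ Z₁ Z₂ \ crect r₁ r₂ z₁ z₂ := by
    rw [Function.support_mul, hFsupp]
    ext q
    rw [mem_inter_iff, Set.mem_sdiff, mem_support, Ne, hFi0 q]
  refine ⟨δ, ⟨hδ0, by linarith⟩, fun q => F q * Fi q, hF.mul hFi, ?_, ?_, ?_, ?_, ?_⟩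
  · exact fun q => ⟨mul_nonneg (hF01 q).1 (hFi01 q).1,
      mul_le_one₀ (hF01 q).2 (hFi01 q).1 (hFi01 q).2⟩
  · rw [tsupport, hsupp]
  · intro q hq
    have h1 : q ∈ support (fun p => F p * Fi p) := by rw [hsupp]; exact hq
    have h2 : F q * Fi q ≠ 0 := h1
    exact lt_of_le_of_ne (mul_nonneg (hF01 q).1 (hFi01 q).1) h2.symm
  · intro q hq
    have hqV := mem_rect.1 hq.1
    have hqW : ¬((r₁ - η ≤ q.1 ∧ q.1 ≤ r₂ + η) ∧ (z₁ - η ≤ q.2 ∧ q.2 ≤ z₂ + η)) := fun h =>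
      hq.2 (mem_crect.2 h)
    change F q * Fi q = 1
    rw [hFone q (rect_mono (by linarith) (by linarith) (by linarith) (by linarith) hq.1),
      one_mul]
    apply hFi1
    by_contra hc
    push Not at hc
    exact hqW ⟨⟨by linarith [hc.1], by linarith [hc.2.1]⟩, by linarith [hc.2.2.1],
      by linarith [hc.2.2.2]⟩
  · intro q hq
    have hqU := hq.1
    have hqV := mem_rect.1 hqU.1
    by_cases hin : q ∈ crect (r₁ - δ) (r₂ + δ) (z₁ - δ) (z₂ + δ)
    · -- the inner `δ`-collar of `W̄`: there `F ≡ 1` near `q`, so `Lf = L Fi`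
      have hin' := mem_crect.1 hin
      have hqO : q ∈ rect (R₁ + η'') (R₂ - η'') (Z₁ + η'') (Z₂ - η'') := by
        rw [mem_rect]
        refine ⟨⟨?_, ?_⟩, ?_, ?_⟩ <;>
          linarith [hin'.1.1, hin'.1.2, hin'.2.1, hin'.2.2]
      have heq : (fun p => F p * Fi p) =ᶠ[𝓝 q] Fi := by
        filter_upwards [(isOpen_rect _ _ _ _).mem_nhds hqO] with p hp
        rw [hFone p hp, one_mul]
      rw [opL_congr_of_eventuallyEq heq]
      refine hFiL q ⟨?_, hqU.2⟩
      rw [mem_crect]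
      refine ⟨⟨?_, ?_⟩, ?_, ?_⟩ <;> linarith [hin'.1.1, hin'.1.2, hin'.2.1, hin'.2.2]
    · -- the outer `δ`-frame of `V`: there `Fi ≡ 1` near `q`, so `Lf = LF`
      have hout : q ∉ rect (R₁ + δ) (R₂ - δ) (Z₁ + δ) (Z₂ - δ) := fun h => hq.2 ⟨h, hin⟩
      have hcase : q.1 ≤ R₁ + δ ∨ R₂ - δ ≤ q.1 ∨ q.2 ≤ Z₁ + δ ∨ Z₂ - δ ≤ q.2 := by
        by_contra h
        push Not at h
        exact hout (mem_rect.2 ⟨⟨h.1, h.2.1⟩, h.2.2.1, h.2.2.2⟩)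
      set S : Set (ℝ × ℝ) :=
        {p | p.1 < r₁ - η'' ∨ r₂ + η'' < p.1 ∨ p.2 < z₁ - η'' ∨ z₂ + η'' < p.2} with hS
      have hSo : IsOpen S :=
        (isOpen_lt continuous_fst continuous_const).union
          ((isOpen_lt continuous_const continuous_fst).union
            ((isOpen_lt continuous_snd continuous_const).union
              (isOpen_lt continuous_const continuous_snd)))
      have hqS : q ∈ S := by
        rcases hcase with h | h | h | h
        · exact Or.inl (by linarith)
        · exact Or.inr (Or.inl (by linarith))
        · exact Or.inr (Or.inr (Or.inl (by linarith)))
        · exact Or.inr (Or.inr (Or.inr (by linarith)))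
      have heq : (fun p => F p * Fi p) =ᶠ[𝓝 q] F := by
        filter_upwards [hSo.mem_nhds hqS] with p hp
        have hp1 : p.1 ≤ r₁ - η'' ∨ r₂ + η'' ≤ p.1 ∨ p.2 ≤ z₁ - η'' ∨ z₂ + η'' ≤ p.2 := by
          rcases hp with h | h | h | h
          · exact Or.inl h.le
          · exact Or.inr (Or.inl h.le)
          · exact Or.inr (Or.inr (Or.inl h.le))
          · exact Or.inr (Or.inr (Or.inr h.le))
        rw [hFi1 p hp1, mul_one]
      rw [opL_congr_of_eventuallyEq heq]
      exact hFL q ⟨hqU.1, fun h => hout (rect_mono (by linarith) (by linarith) (by linarith)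
        (by linarith) h)⟩

end Literature.Barriers.NavierStokesRegularity
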